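import Summits.QuantumFields.YangMills.Theorems.ColdStartUniversalityLatticeLangevinWilsonLqProduction
import Summits.QuantumFields.YangMills.Theorems.ColdStartUniversalityLatticeLangevinWilsonEntropyDecay
import Summits.QuantumFields.YangMills.Theorems.ColdStartUniversalityLqFlowTools
import HarnessLib

/-!
# Route `ColdStartUniversality` (fixed-cut-off package, `Lᵖ` side): the DINI STEP of Gross's theorem for the SZZ semigroup —
# `log‖κ_h v‖_{q_h}/1 − log‖v‖_q < r·h` eventually, `q_h = 1 + (q−1)e^{4ρh}`, under the generator-form log-Sobolev inequality

Helper file (seat `ym-line-csu-p1`, g36; `--supports stmt-QuantumFields-24809`).  SU(2) lattice Langevin dynamics of Shen–Zhu–Zhu at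
`(L, β')`, Wilson measure `μ = μ_{β'}`, ANY realising kernel family `κ`.  HYPOTHESIS: the generator-form log-Sobolev inequality
`ρ·Ent_μ(F²) ≤ −∫ F·𝓛f dμ` on `C³` cylinders (`ρ ≥ 0`).  For a continuous `v ≥ δ > 0` with the Dynkin-type Lipschitz bound
`|κ_h v − v| ≤ Ch` (every `v = κ_tF`, `F` a `C³` compactly supported cylinder, has one) and `1 < q`, one lattice step `h` of the
quantity `log(∫ (κ_h v)^{q_h} dμ)/q_h`, `q_h = 1 + (q−1)e^{4ρh}`, is controlled by: the scale-`h` `L^q` PRODUCTION inequality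
(`integral_rpow_transition_sub_le_dirichletScale`, Stroock–Varopoulos), the semigroup-form log-Sobolev inequality at `v^{q/2}`
(`semigroupLogSobolev_of_generatorLogSobolev` + `dirichletScale_antitone`), the exponent change (`LqFlow.integral_rpow_add_le`), the
Lipschitz comparison `∫(κ_hv)^q log κ_hv` vs `∫ v^q log v` (`LqFlow.abs_integral_rpow_mul_log_sub_le`) and the cancellation
`q'(t)·Ent = 4ρ(q−1)·Ent` (`LqFlow.gross_slope_lt`):
* ★★ `lqNorm_log_transition_slope_lt_of_generatorLogSobolev` — for every `r > 0` there is `h* > 0` with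
  `log(∫ (κ_h v)^{q_h} dμ)/q_h − log(∫ v^q dμ)/q < r·h` for `0 < h < h*`.
The fencing (`‖κ_tF‖_{q(t)} ≤ ‖F‖_p`) is the sequel `…LatticeLangevinHypercontractivity`.

THEOREMS ONLY, no definition, no sorry.  HONEST FRAMING: RECORD-rung R3 plumbing at FIXED cut-off; the log-Sobolev constant is the
HYPOTHESIS; nothing K-uniform is proved; no crux, rung or summit statement is proved; the Yang–Mills mass gap is NOT proved.
-/

set_option autoImplicit false

noncomputable section

namespace Summit.QuantumFields.YangMills.Theorems.ColdStartUniversality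

open MeasureTheory ProbabilityTheory Filter Set Topology
open scoped BigOperators NNReal ENNReal
open Literature.Probability.Process Literature.MathematicalPhysics.QuantumFieldTheory
open Literature.MathematicalPhysics.QuantumLattice (fundamentalRep fundamentalLatticeRep continuous_fundamentalRep)

variable {L : ℕ} [NeZero L]

/-! ## §1. The Dini step -/

/-- ★★ **The Dini step of Gross's theorem.**  Under the generator-form log-Sobolev inequality with constant `ρ ≥ 0`, let `v` be
continuous with `δ ≤ v` (`δ > 0`), `|κ_h v − v| ≤ C h` for all `h`, and let `1 < q`.  Then for every `r > 0` there is `h* > 0` with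

  `log(∫ (κ_h v)^{q_h} dμ)/q_h − log(∫ v^q dμ)/q < r·h`   for all `0 < h < h*`,   `q_h = 1 + (q−1)e^{4ρh}`.

[cite: DiaconisSaloffcoste1996, §3.2 proof of Theorem 3.5 (ii)] -/
theorem lqNorm_log_transition_slope_lt_of_generatorLogSobolev (L : ℕ) [NeZero L] (β' : ℝ)
    (κ : ℝ≥0 → Kernel (GaugeConfig 3 L (Matrix.specialUnitaryGroup (Fin 2) ℂ))
      (GaugeConfig 3 L (Matrix.specialUnitaryGroup (Fin 2) ℂ))) [∀ t, IsMarkovKernel (κ t)]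
    (hreal : ∀ (t : ℝ≥0) (x : GaugeConfig 3 L (Matrix.specialUnitaryGroup (Fin 2) ℂ))
        (Ω : Type) [MeasurableSpace Ω] (P : Measure Ω) [IsProbabilityMeasure P]
        (W : ℝ≥0 → Ω → (Edge 3 L × NoiseIdx 2 → ℝ)) (hW : IsFlatBrownian W P)
        (U : ℝ≥0 → Ω → GaugeConfig 3 L (Matrix.specialUnitaryGroup (Fin 2) ℂ)),
        (∀ ω, U 0 ω = x) →
        (latticeLangevinDynamics (fundamentalLatticeRep 2) β').IsSolution (fundamentalRep (Fin 2))
          hW.natFiltration P W U →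
        κ t x = P.map (U t))
    {ρ : ℝ} (hρ : 0 ≤ ρ)
    (hLSgen : ∀ (f : (Edge 3 L × Fin 2 × Fin 2 × Bool → ℝ) → ℝ), ContDiff ℝ 3 f →
        let coords : GaugeConfig 3 L (Matrix.specialUnitaryGroup (Fin 2) ℂ) → (Edge 3 L × Fin 2 × Fin 2 × Bool → ℝ) :=
          fun V q => (fun z : ℂ => if q.2.2.2 then z.im else z.re)
            ((fundamentalRep (Fin 2) (V q.1) : Matrix (Fin 2) (Fin 2) ℂ) q.2.1 q.2.2.1)
        let gen : GaugeConfig 3 L (Matrix.specialUnitaryGroup (Fin 2) ℂ) → ℝ := fun V =>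
          (∑ i : Edge 3 L × Fin 2 × Fin 2 × Bool, fderiv ℝ f (coords V) (Pi.single i 1) *
              (fun z : ℂ => if i.2.2.2 then z.im else z.re)
                ((latticeLangevinDynamics (fundamentalLatticeRep 2) β').drift
                  (matrixConfig (fundamentalRep (Fin 2)) V) i.1 i.2.1 i.2.2.1) +
          1 / 2 * ∑ i : Edge 3 L × Fin 2 × Fin 2 × Bool, ∑ j : Edge 3 L × Fin 2 × Fin 2 × Bool,
            fderiv ℝ (fun z => fderiv ℝ f z (Pi.single i 1)) (coords V) (Pi.single j 1) *
              ∑ n : Edge 3 L × NoiseIdx 2,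
                (if n.1 = i.1 then (fun z : ℂ => if i.2.2.2 then z.im else z.re)
                  ((latticeLangevinDynamics (fundamentalLatticeRep 2) β').noise
                    (matrixConfig (fundamentalRep (Fin 2)) V) i.1 n.2 i.2.1 i.2.2.1) else 0) *
                (if n.1 = j.1 then (fun z : ℂ => if j.2.2.2 then z.im else z.re)
                  ((latticeLangevinDynamics (fundamentalLatticeRep 2) β').noise
                    (matrixConfig (fundamentalRep (Fin 2)) V) j.1 n.2 j.2.1 j.2.2.1) else 0))
        ρ * ((∫ V, f (coords V) ^ 2 * Real.log (f (coords V) ^ 2) ∂(wilsonMeasure (d := 3) (L := L) (fundamentalRep (Fin 2)) β')) -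
            (∫ V, f (coords V) ^ 2 ∂(wilsonMeasure (d := 3) (L := L) (fundamentalRep (Fin 2)) β')) *
              Real.log (∫ V, f (coords V) ^ 2 ∂(wilsonMeasure (d := 3) (L := L) (fundamentalRep (Fin 2)) β'))) ≤
          -∫ V, f (coords V) * gen V ∂(wilsonMeasure (d := 3) (L := L) (fundamentalRep (Fin 2)) β'))
    {v : GaugeConfig 3 L (Matrix.specialUnitaryGroup (Fin 2) ℂ) → ℝ} (hvc : Continuous v) {δ : ℝ} (hδ : 0 < δ)
    (hvδ : ∀ x, δ ≤ v x) {C : ℝ} (hC : ∀ (h : ℝ≥0) (x : GaugeConfig 3 L (Matrix.specialUnitaryGroup (Fin 2) ℂ)),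
      |(∫ y, v y ∂(κ h x)) - v x| ≤ C * h)
    {q : ℝ} (hq : 1 < q) {r : ℝ} (hr : 0 < r) :
    ∃ hstar : ℝ, 0 < hstar ∧ ∀ h : ℝ≥0, 0 < h → (h : ℝ) < hstar →
      Real.log (∫ x, (∫ y, v y ∂(κ h x)) ^ (1 + (q - 1) * Real.exp (4 * ρ * h))
          ∂(wilsonMeasure (d := 3) (L := L) (fundamentalRep (Fin 2)) β')) / (1 + (q - 1) * Real.exp (4 * ρ * h)) -
        Real.log (∫ x, v x ^ q ∂(wilsonMeasure (d := 3) (L := L) (fundamentalRep (Fin 2)) β')) / q < r * h := by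
  classical
  haveI := secondCountableTopology_su2
  haveI := borelSpace_config L
  set μ : Measure (GaugeConfig 3 L (Matrix.specialUnitaryGroup (Fin 2) ℂ)) :=
    wilsonMeasure (d := 3) (L := L) (fundamentalRep (Fin 2)) β' with hμ
  haveI : IsProbabilityMeasure μ :=
    isProbabilityMeasure_wilsonMeasure (d := 3) (L := L) (fundamentalRep (Fin 2)) (continuous_fundamentalRep (Fin 2)) β'
  have hq1 : 1 ≤ q := hq.le
  have hq0 : 0 < q := by linarith
  have hvpos : ∀ x, 0 < v x := fun x => lt_of_lt_of_le hδ (hvδ x)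
  obtain ⟨B, -, hBabs⟩ := exists_abs_le_of_continuous hvc
  have hvB : ∀ x, v x ≤ B := fun x => (le_abs_self _).trans (hBabs x)
  have hδB : δ ≤ B := (hvδ (Classical.arbitrary _)).trans (hvB _)
  have hB0 : 0 < B := lt_of_lt_of_le hδ hδB
  have hC0 : 0 ≤ C := by
    have h1 := hC 1 (Classical.arbitrary _)
    have : (0 : ℝ) ≤ C * ((1 : ℝ≥0) : ℝ) := (abs_nonneg _).trans h1
    simpa using this
  -- `N = ∫ v^q`, `X = ∫ v^q log v`, `E = Ent(v^q) = qX − N log N ≥ 0`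
  have hvq : Continuous fun x => v x ^ q := hvc.rpow_const fun x => Or.inl (hvpos x).ne'
  have hvlog : Continuous fun x => Real.log (v x) := hvc.log fun x => (hvpos x).ne'
  set N : ℝ := ∫ x, v x ^ q ∂μ with hN
  set X : ℝ := ∫ x, v x ^ q * Real.log (v x) ∂μ with hX
  have hNpos : 0 < N := by
    have h1 : δ ^ q ≤ N := by
      have := integral_mono (integrable_const (δ ^ q)) (integrable_of_continuous_of_compactSpace hvq μ)
        fun x => Real.rpow_le_rpow hδ.le (hvδ x) hq0.le
      rwa [integral_const, probReal_univ, one_smul] at this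
    exact lt_of_lt_of_le (Real.rpow_pos_of_pos hδ q) h1
  set Lg : ℝ := Real.log N with hLg
  set E : ℝ := q * X - N * Lg with hE
  have elog : ∀ x, Real.log (v x ^ q) = q * Real.log (v x) := fun x => Real.log_rpow (hvpos x) q
  have eX : ∫ x, v x ^ q * Real.log (v x ^ q) ∂μ = q * X := by
    rw [hX, ← integral_const_mul]
    refine integral_congr_ae (Eventually.of_forall fun x => ?_)
    simp only [elog]; ring
  have hE0 : 0 ≤ E := by
    have h := entropy_nonneg μ (g := fun x => v x ^ q) (fun x => (Real.rpow_pos_of_pos (hvpos x) q).le)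
      (integrable_of_continuous_of_compactSpace hvq μ)
      (integrable_of_continuous_of_compactSpace (hvq.mul (hvq.log fun x => (Real.rpow_pos_of_pos (hvpos x) q).ne')) μ)
    rw [eX] at h
    exact h
  -- `Λ`, `M`, `M₁` : bounds on `[δ, B]`
  set Λ : ℝ := max |Real.log δ| |Real.log B| with hΛ
  have hΛ0 : 0 ≤ Λ := le_max_of_le_left (abs_nonneg _)
  have hΛI : ∀ ξ, δ ≤ ξ → ξ ≤ B → |Real.log ξ| ≤ Λ := by
    intro ξ h1 h2
    have hξ : 0 < ξ := lt_of_lt_of_le hδ h1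
    have hl1 : Real.log δ ≤ Real.log ξ := Real.log_le_log hδ h1
    have hl2 : Real.log ξ ≤ Real.log B := Real.log_le_log hξ h2
    rw [abs_le]
    constructor
    · have := neg_abs_le (Real.log δ)
      have : |Real.log δ| ≤ Λ := le_max_left _ _
      linarith [neg_abs_le (Real.log δ)]
    · exact (hl2.trans (le_abs_self _)).trans (le_max_right _ _)
  obtain ⟨M, hM⟩ := (isCompact_Icc : IsCompact (Icc δ B)).exists_bound_of_continuousOn
    (f := fun ξ : ℝ => ξ ^ (q - 2)) (ContinuousOn.rpow_const continuousOn_id fun ξ hξ => Or.inl (lt_of_lt_of_le hδ hξ.1).ne')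
  have hM' : ∀ ξ, δ ≤ ξ → ξ ≤ B → ξ ^ (q - 2) ≤ M := fun ξ h1 h2 =>
    (le_abs_self _).trans (by simpa [Real.norm_eq_abs] using hM ξ ⟨h1, h2⟩)
  have hM0 : 0 ≤ M := (norm_nonneg _).trans (hM δ ⟨le_rfl, hδB⟩)
  obtain ⟨M₁, hM₁⟩ := (isCompact_Icc : IsCompact (Icc δ B)).exists_bound_of_continuousOn
    (f := fun ξ : ℝ => ξ ^ (q - 1) * (q * Real.log ξ + 1))
    ((ContinuousOn.rpow_const continuousOn_id fun ξ hξ => Or.inl (lt_of_lt_of_le hδ hξ.1).ne').mul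
      (((continuousOn_id.log fun ξ hξ => (lt_of_lt_of_le hδ hξ.1).ne').const_smul q |>.congr
        (fun ξ _ => by simp [smul_eq_mul])).add continuousOn_const))
  have hM₁' : ∀ ξ, δ ≤ ξ → ξ ≤ B → |ξ ^ (q - 1) * (q * Real.log ξ + 1)| ≤ M₁ := fun ξ h1 h2 => by
    simpa [Real.norm_eq_abs] using hM₁ ξ ⟨h1, h2⟩
  have hM₁0 : 0 ≤ M₁ := (norm_nonneg _).trans (hM₁ δ ⟨le_rfl, hδB⟩)
  -- constants
  set A : ℝ := q * (q - 1) * M * C ^ 2 with hA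
  have hq10 : 0 ≤ q - 1 := by linarith
  have hA0 : 0 ≤ A := by rw [hA]; positivity
  set E₁ : ℝ := 4 * ρ * (q - 1) * Real.exp (4 * ρ) with hE₁
  set E₂ : ℝ := 16 * ρ ^ 2 * (q - 1) * Real.exp (4 * ρ) with hE₂
  have hE₁0 : 0 ≤ E₁ := by rw [hE₁]; positivity
  have hE₂0 : 0 ≤ E₂ := by rw [hE₂]; positivity
  set Bq : ℝ := B ^ q with hBq
  have hBq0 : 0 ≤ Bq := (Real.rpow_pos_of_pos hB0 q).le
  set K : ℝ := |Lg| * E₂ + (A + E₂ * |X| + E₁ * (M₁ * C) + E₁ ^ 2 * Λ ^ 2 * Bq) / N with hK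
  have hK0 : 0 ≤ K := by
    have h1 : 0 ≤ (A + E₂ * |X| + E₁ * (M₁ * C) + E₁ ^ 2 * Λ ^ 2 * Bq) / N := by
      apply div_nonneg _ hNpos.le
      have : 0 ≤ E₂ * |X| := mul_nonneg hE₂0 (abs_nonneg X)
      have : 0 ≤ E₁ * (M₁ * C) := mul_nonneg hE₁0 (mul_nonneg hM₁0 hC0)
      have : 0 ≤ E₁ ^ 2 * Λ ^ 2 * Bq := mul_nonneg (mul_nonneg (sq_nonneg _) (sq_nonneg _)) hBq0
      linarith
    have h2 : 0 ≤ |Lg| * E₂ := mul_nonneg (abs_nonneg _) hE₂0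
    simp only [hK]; linarith
  -- the choice of `η` and the semigroup log-Sobolev inequality at `G = v^{q/2}`
  set c : ℝ := 4 * (q - 1) / q with hc
  have hc0 : 0 ≤ c := div_nonneg (by linarith) hq0.le
  set η : ℝ := r * N / (2 * (c * E + 1)) with hη
  have hcE : 0 ≤ c * E := mul_nonneg hc0 hE0
  have hηpos : 0 < η := by rw [hη]; positivity
  have hηr : c * η * E / N ≤ r / 2 := by
    have e : c * η * E / N = r / 2 * (c * E / (c * E + 1)) := by
      rw [hη]; field_simp
    rw [e]
    have h1 : c * E / (c * E + 1) ≤ 1 := by rw [div_le_one (by linarith)]; linarith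
    calc r / 2 * (c * E / (c * E + 1)) ≤ r / 2 * 1 := mul_le_mul_of_nonneg_left h1 (by linarith)
      _ = r / 2 := mul_one _
  have hGc : Continuous fun x => v x ^ (q / 2) := hvc.rpow_const fun x => Or.inl (hvpos x).ne'
  obtain ⟨h₁, hh₁, hLS⟩ := semigroupLogSobolev_of_generatorLogSobolev L β' κ hreal hLSgen hGc hηpos
  have esq : ∀ x, (v x ^ (q / 2)) ^ 2 = v x ^ q := fun x => by
    rw [← Real.rpow_natCast, ← Real.rpow_mul (hvpos x).le]; norm_num
  simp only [esq, elog] at hLS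
  -- `hLS : (ρ − η)·E ≤ h₁⁻¹·(∫ GG − ∫ G κ_{h₁} G)` after the identification `∫ v^q (q log v) = qX`
  have eX' : ∫ x, v x ^ q * (q * Real.log (v x)) ∂μ = q * X := by
    rw [hX, ← integral_const_mul]
    refine integral_congr_ae (Eventually.of_forall fun x => ?_); ring
  rw [eX'] at hLS
  -- the threshold
  have hEΛ1 : 0 < E₁ * Λ + 1 := by have := mul_nonneg hE₁0 hΛ0; linarith only [this]
  have h2K1 : 0 < 2 * K + 1 := by linarith only [hK0]
  refine ⟨min (h₁ : ℝ) (min 1 (min (1 / (E₁ * Λ + 1)) (r / (2 * K + 1)))),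
    lt_min (by exact_mod_cast hh₁) (lt_min one_pos (lt_min (div_pos one_pos hEΛ1) (div_pos hr h2K1))),
    fun h hh hhlt => ?_⟩
  have hhR : (0 : ℝ) < h := by exact_mod_cast hh
  have hhh₁ : h ≤ h₁ := by exact_mod_cast (hhlt.le.trans (min_le_left _ _))
  have hh1 : (h : ℝ) ≤ 1 := hhlt.le.trans ((min_le_right _ _).trans (min_le_left _ _))
  have hh2 : (h : ℝ) ≤ 1 / (E₁ * Λ + 1) :=
    hhlt.le.trans ((min_le_right _ _).trans ((min_le_right _ _).trans (min_le_left _ _)))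
  have hh3 : (h : ℝ) < r / (2 * K + 1) :=
    lt_of_lt_of_le hhlt ((min_le_right _ _).trans ((min_le_right _ _).trans (min_le_right _ _)))
  -- `w = κ_h v`
  set w : GaugeConfig 3 L (Matrix.specialUnitaryGroup (Fin 2) ℂ) → ℝ := fun x => ∫ y, v y ∂(κ h x) with hw
  have hwc : Continuous w := continuous_integral_transitionKernel L β' κ hreal h hvc
  have hδw : ∀ x, δ ≤ w x := by
    intro x
    have := integral_mono (integrable_const (μ := κ h x) δ) (integrable_of_continuous_of_compactSpace hvc _) fun y => hvδ y
    rwa [integral_const, probReal_univ, one_smul] at this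
  have hwB : ∀ x, w x ≤ B := by
    intro x
    have := integral_mono (integrable_of_continuous_of_compactSpace hvc _) (integrable_const (μ := κ h x) B) fun y => hvB y
    rwa [integral_const, probReal_univ, one_smul] at this
  have hwpos : ∀ x, 0 < w x := fun x => lt_of_lt_of_le hδ (hδw x)
  have hD : ∀ x, |w x - v x| ≤ C * h := fun x => hC h x
  -- the exponent increment
  set ε : ℝ := (q - 1) * (Real.exp (4 * ρ * h) - 1) with hε
  have heq : 1 + (q - 1) * Real.exp (4 * ρ * h) = q + ε := by rw [hε]; ring
  obtain ⟨hεlo', hεhi', hε2'⟩ := LqFlow.exponent_increment_bounds hρ hq1 hhR.le hh1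
  have hεlo : 4 * (q - 1) * ρ * h ≤ ε := by rw [hε]; linarith only [hεlo']
  have hεhi : ε ≤ E₁ * h := by rw [hε, hE₁]; exact hεhi'
  have hε2 : ε - 4 * (q - 1) * ρ * h ≤ E₂ * h ^ 2 := by rw [hε, hE₂]; exact hε2'
  have h4q : 0 ≤ 4 * (q - 1) * ρ * (h : ℝ) := by positivity
  have hε0 : 0 ≤ ε := h4q.trans hεlo
  have hεΛ : ε * Λ ≤ 1 := by
    have h1 : ε * Λ ≤ E₁ * h * Λ := mul_le_mul_of_nonneg_right hεhi hΛ0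
    have h2 : (h : ℝ) * (E₁ * Λ + 1) ≤ 1 := (le_div_iff₀ hEΛ1).1 hh2
    have e : E₁ * (h : ℝ) * Λ = h * (E₁ * Λ) := by ring
    have e2 : (h : ℝ) * (E₁ * Λ + 1) = h * (E₁ * Λ) + h := by ring
    rw [e] at h1
    linarith only [h1, h2, e2, hhR]
  -- (P) production + log-Sobolev
  have hP0 := integral_rpow_transition_sub_le_dirichletScale L β' κ hreal h hvc hδ hvδ hvB hq hM' hD
  have hanti := dirichletScale_antitone L β' κ hreal hh hhh₁ hGc
  have hbr : h * ((ρ - η) * E) ≤ (∫ x, v x ^ (q / 2) * v x ^ (q / 2) ∂μ) -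
      ∫ x, v x ^ (q / 2) * (∫ y, v y ^ (q / 2) ∂(κ h x)) ∂μ := by
    have h1 := hLS.trans hanti
    rw [inv_mul_eq_div, le_div_iff₀ hhR] at h1
    -- `E` is by definition `qX − N log N`
    have h2 : (ρ - η) * E * h ≤ (∫ x, v x ^ (q / 2) * v x ^ (q / 2) ∂μ) -
        ∫ x, v x ^ (q / 2) * (∫ y, v y ^ (q / 2) ∂(κ h x)) ∂μ := h1
    have e : (h : ℝ) * ((ρ - η) * E) = (ρ - η) * E * h := by ring
    rw [e]; exact h2
  -- the production inequality, restated for `w` and `N`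
  have hP1 : (∫ x, w x ^ q ∂μ) - N ≤
      -(4 * (q - 1) / q) * ((∫ x, v x ^ (q / 2) * v x ^ (q / 2) ∂μ) -
        ∫ x, v x ^ (q / 2) * (∫ y, v y ^ (q / 2) ∂(κ h x)) ∂μ) + q * (q - 1) * M * (C * h) ^ 2 := hP0
  have hP : (∫ x, w x ^ q ∂μ) ≤ N - 4 * (q - 1) / q * h * (ρ - η) * E + A * h ^ 2 := by
    have e : q * (q - 1) * M * (C * h) ^ 2 = A * h ^ 2 := by rw [hA]; ring
    rw [e] at hP1
    have h2 : -(4 * (q - 1) / q) * ((∫ x, v x ^ (q / 2) * v x ^ (q / 2) ∂μ) -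
        ∫ x, v x ^ (q / 2) * (∫ y, v y ^ (q / 2) ∂(κ h x)) ∂μ) ≤ -(4 * (q - 1) / q) * (h * ((ρ - η) * E)) :=
      mul_le_mul_of_nonpos_left hbr (by rw [neg_nonpos]; exact hc0)
    have h3 : (∫ x, w x ^ q ∂μ) - N ≤ -(4 * (q - 1) / q) * (h * ((ρ - η) * E)) + A * h ^ 2 :=
      hP1.trans (by linarith only [h2])
    have e2 : -(4 * (q - 1) / q) * (h * ((ρ - η) * E)) = -(4 * (q - 1) / q * h * (ρ - η) * E) := by ring
    rw [e2] at h3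
    linarith only [h3]
  -- (X) exponent change, with `∫ w^q ≤ B^q`
  have hΛw : ∀ x, |Real.log (w x)| ≤ Λ := fun x => hΛI (w x) (hδw x) (hwB x)
  have hXch0 := LqFlow.integral_rpow_add_le μ hwc hwpos (q := q) hΛw hε0 hεΛ
  have hwq : Continuous fun x => w x ^ q := hwc.rpow_const fun x => Or.inl (hwpos x).ne'
  have hNwB : ∫ x, w x ^ q ∂μ ≤ Bq := by
    have := integral_mono (integrable_of_continuous_of_compactSpace hwq μ) (integrable_const Bq)
      fun x => Real.rpow_le_rpow (hwpos x).le (hwB x) hq0.le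
    rwa [integral_const, probReal_univ, one_smul] at this
  have hXch : ∫ x, w x ^ (q + ε) ∂μ ≤ (∫ x, w x ^ q ∂μ) + ε * (∫ x, w x ^ q * Real.log (w x) ∂μ) + (ε * Λ) ^ 2 * Bq := by
    have h3 := mul_le_mul_of_nonneg_left hNwB (sq_nonneg (ε * Λ))
    linarith only [hXch0, h3]
  -- (Lip)
  have hLip0 := LqFlow.abs_integral_rpow_mul_log_sub_le μ hwc hvc (q := q) hδ hδw hwB hvδ hvB hM₁' hD
  rw [probReal_univ, mul_one] at hLip0
  have hLip : |(∫ x, w x ^ q * Real.log (w x) ∂μ) - X| ≤ M₁ * C * h := by rw [hX]; simpa [mul_assoc] using hLip0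
  -- `N' > 0`
  have hN'pos : 0 < ∫ x, w x ^ (q + ε) ∂μ := by
    have hwq' : Continuous fun x => w x ^ (q + ε) := hwc.rpow_const fun x => Or.inl (hwpos x).ne'
    have h1 : δ ^ (q + ε) ≤ ∫ x, w x ^ (q + ε) ∂μ := by
      have := integral_mono (integrable_const (δ ^ (q + ε))) (integrable_of_continuous_of_compactSpace hwq' μ)
        fun x => Real.rpow_le_rpow hδ.le (hδw x) (by linarith)
      rwa [integral_const, probReal_univ, one_smul] at this
    exact lt_of_lt_of_le (Real.rpow_pos_of_pos hδ _) h1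
  -- assemble
  have hhK : (h : ℝ) * (2 * K + 1) < r := (lt_div_iff₀ h2K1).1 hh3
  have hfinal := LqFlow.gross_slope_lt (N := N) (N' := ∫ x, w x ^ (q + ε) ∂μ) (Nw := ∫ x, w x ^ q ∂μ) (X := X)
    (Xw := ∫ x, w x ^ q * Real.log (w x) ∂μ) (E := E) (L := Lg) (q := q) (ε := ε) (h := h) (ρ := ρ) (η := η) (A := A)
    (M₁C := M₁ * C) (Λ := Λ) (Bq := Bq) (E₁ := E₁) (E₂ := E₂) (r := r) (K := K)
    hNpos hN'pos hq1 hhR hρ hηpos.le hA0 (mul_nonneg hM₁0 hC0) hBq0 hE0 hLg hE hP hXch hLip hεlo hεhi hε2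
    (by simpa [hc] using hηr) hK hhK
  rw [heq]
  exact hfinal

end Summit.QuantumFields.YangMills.Theorems.ColdStartUniversality

end
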